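import Mathlib
import HarnessLib
import Literature.Computability.AlgebraicComplexity.DegenerationSpectralMonotone
import Literature.Computability.AlgebraicComplexity.BorderRankCWKoszulRanksSqThree
import Summits.MatrixMultiplication.MatrixMultiplication.Theorems.OutsiderSandwichBorderSubrankSeven

/-!
# OutsiderSandwich — `⟨20⟩ ⊴₅₆ cw₂^{⊠3}`: the border subrank of the Kronecker cube of `T_{cw,2}` is `≥ 20`
(decomp-mm lens 4 «minimal-counterexample / extremal reduction», gen 42, kernel K42-g; THESES-FREE;
definitions = the certificate tables only, as in K42-d/K42-e)

Host: `cw₂^{⊠3} = kroneckerPow (cwTensor R 2) 3` on the index type `Fin 3 → Fin 3` (format `27³`, support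
`Φ₃` = the `216` triples of `cw₂`-triples).  Restriction side in kernel: `14 ≤ Q(cw₂^{⊠3}) ≤ 21`
(`OutsiderSandwichCwCubeSubrank.fourteen_le_subrank_cwPow_three_complex`,
`OutsiderSandwichHammingBound.subrank_cwPow_three_le`); degeneration side so far: `⟨27⟩ ⋬ cw₂^{⊠3}`
(`OutsiderSandwichBorderSubrankCeiling.not_unitTensor_twentySeven_deg_cwTwoPow_three`, K42-f) and, one power
down, `⟨7⟩ ⊴₄ cw₂^{⊠2}` with `Q(cw₂^{⊠2}) = 6` (K42-e).

**This file proves:**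

* `isApproxRestriction_of_monomial` — the general certificate shape behind every COMBINATORIAL degeneration
  (BCS (15.29)–(15.30)) in the form the kernel checks fastest: if the three matrices are MONOMIAL — row `x`
  of `A(ε)` is `ε^{α x}` in the single column `σA x` — then `(A ⊗ B ⊗ C)·s` has the single term
  `ε^{α x + β y + γ z}·s(σA x, σB y, σC z)` at `(x, y, z)`, so an approximate restriction of order `K` is
  exactly the pair of finite checks `h₁` (every host entry met below order `K` vanishes) and `h₂` (the
  order-`K` layer is the target).  No injectivity hypothesis is needed; it is implied by `h₂` for unit targets.
* `cert₁`, `cert₂` (by `decide` over `ℤ`, one target row at a time) and `isApproxRestriction` — an explicit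
  combinatorial degeneration of order `56`: a diagonal `Ψ ⊂ Φ₃` of size `20` (tables `σA σB σC`: the host
  coordinate of each of the `20` target coordinates, per leg) and weights `wA ≤ 41`, `wB ≤ 53`, `wC ≤ 34`
  with `wA + wB + wC = 56` exactly on `Ψ` and `≥ 57` on the other `63` triples of `Φ₃` inside the used
  coordinates.  Found by random search over maximal diagonals of `Φ₃` with an exact rational LP for the
  weights (`combdeg3.py`, `lp3_minK.py`: the least order for this `Ψ` is `56`, attained at an integral
  vertex), verified independently (`mk_u20_tables.py`) and here in kernel.
* `unitTensor_twenty_deg_cwTwoPow_three` — `⟨20⟩ ⊴ cw₂^{⊠3}` over every commutative ring; instance over `ℂ`.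

Census reading (decomp-mm lens 4; `LaserTangency`, stmt-32268, is instrumented by RESTRICTION tables): the
`N = 3` diagonal cell reads `[14, 21]` by restriction and `[20, 26]` by degeneration (`27` excluded, K42-f);
per-copy rates `20^{1/3} ≈ 2.714 > 7^{1/2} ≈ 2.646` (`N = 2`, K42-e) `> 2 = Q̲(cw₂)`, against the asymptotic
value `Q̃(cw₂) = 3`.  Sizes `21, 22` were not found by the same search (≈ `2900` LPs; not exhaustive).
Informal, not restated: a size-`22` certificate would separate degeneration from restriction at `N = 3` by
order alone.  No `sorry`, standard axioms, no `native_decide`.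
-/

set_option linter.dupNamespace false

namespace Summit.MatrixMultiplication.MatrixMultiplication.Theorems.OutsiderSandwichBorderSubrankTwenty

open scoped BigOperators Polynomial
open Polynomial (X C)
open Literature.Computability.AlgebraicComplexity
open Summit.MatrixMultiplication.MatrixMultiplication.Theorems.OutsiderSandwichBorderSubrankSeven
  (intCast_unitTensor)

variable {R : Type} [CommRing R]

/-! ## The monomial certificate shape -/

/-- A monomial row collapses the sum over a leg to one term. [folklore] -/
theorem sum_monomial_mul {ι : Type} [Fintype ι] [DecidableEq ι] (σ : ι) (w : ℕ) (f : ι → R[X]) :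
    (∑ a, (if a = σ then (X : R[X]) ^ w else 0) * f a) = X ^ w * f σ := by
  rw [Finset.sum_eq_single σ]
  · simp
  · intro a _ ha
    simp [ha]
  · intro h
    exact absurd (Finset.mem_univ σ) h

/-- **Monomial approximate restrictions** (the kernel form of a combinatorial degeneration,
BCS (15.29)–(15.30)): with monomial matrices `x ↦ ε^{α x}·e_{σA x}` etc., `t` is the order-`K` layer of
`(A ⊗ B ⊗ C)·s` and nothing lies below it as soon as (`h₁`) every host entry `s(σA x, σB y, σC z)` of
weight `< K` vanishes and (`h₂`) the entries of weight exactly `K` form `t`.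
[cite: BurgisserClausenShokrollahi1997, (15.30)] -/
theorem isApproxRestriction_of_monomial {ι κ μ : Type} [Fintype ι] [Fintype κ] [Fintype μ]
    [DecidableEq ι] [DecidableEq κ] [DecidableEq μ] {n : ℕ} (K : ℕ) (s : ι → κ → μ → R)
    (t : Fin n → Fin n → Fin n → R) (σA : Fin n → ι) (σB : Fin n → κ) (σC : Fin n → μ)
    (α β γ : Fin n → ℕ)
    (h₁ : ∀ x y z, α x + β y + γ z < K → s (σA x) (σB y) (σC z) = 0)
    (h₂ : ∀ x y z, (if α x + β y + γ z = K then s (σA x) (σB y) (σC z) else 0) = t x y z) :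
    IsApproxRestriction K s t (fun x a => if a = σA x then (X : R[X]) ^ (α x) else 0)
      (fun y b => if b = σB y then (X : R[X]) ^ (β y) else 0)
      (fun z c => if c = σC z then (X : R[X]) ^ (γ z) else 0) := by
  intro x y z j hj
  have hsum : (∑ a, ∑ b, ∑ c, (if a = σA x then (X : R[X]) ^ (α x) else 0) *
      (if b = σB y then (X : R[X]) ^ (β y) else 0) * (if c = σC z then (X : R[X]) ^ (γ z) else 0) *
        C (s a b c)) =
      C (s (σA x) (σB y) (σC z)) * X ^ (α x + β y + γ z) := by
    have inner : ∀ a b, (∑ c, (if a = σA x then (X : R[X]) ^ (α x) else 0) *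
        (if b = σB y then (X : R[X]) ^ (β y) else 0) * (if c = σC z then (X : R[X]) ^ (γ z) else 0) *
          C (s a b c)) =
        (if a = σA x then (X : R[X]) ^ (α x) else 0) * (if b = σB y then (X : R[X]) ^ (β y) else 0) *
          ((X : R[X]) ^ (γ z) * C (s a b (σC z))) := by
      intro a b
      rw [← sum_monomial_mul (σC z) (γ z) (fun c => C (s a b c)), Finset.mul_sum]
      refine Finset.sum_congr rfl fun c _ => ?_
      ring
    simp_rw [inner]
    have mid : ∀ a, (∑ b, (if a = σA x then (X : R[X]) ^ (α x) else 0) *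
        (if b = σB y then (X : R[X]) ^ (β y) else 0) * ((X : R[X]) ^ (γ z) * C (s a b (σC z)))) =
        (if a = σA x then (X : R[X]) ^ (α x) else 0) *
          ((X : R[X]) ^ (β y) * ((X : R[X]) ^ (γ z) * C (s a (σB y) (σC z)))) := by
      intro a
      rw [← sum_monomial_mul (σB y) (β y) (fun b => (X : R[X]) ^ (γ z) * C (s a b (σC z))),
        Finset.mul_sum]
      refine Finset.sum_congr rfl fun b _ => ?_
      ring
    simp_rw [mid]
    rw [← Finset.sum_congr rfl fun a _ => (mul_comm _ _), ]
    rw [show (∑ a, (X : R[X]) ^ (β y) * ((X : R[X]) ^ (γ z) * C (s a (σB y) (σC z))) *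
        (if a = σA x then (X : R[X]) ^ (α x) else 0)) =
        ∑ a, (if a = σA x then (X : R[X]) ^ (α x) else 0) *
          ((X : R[X]) ^ (β y) * ((X : R[X]) ^ (γ z) * C (s a (σB y) (σC z)))) from
        Finset.sum_congr rfl fun a _ => mul_comm _ _]
    rw [sum_monomial_mul (σA x) (α x)
      (fun a => (X : R[X]) ^ (β y) * ((X : R[X]) ^ (γ z) * C (s a (σB y) (σC z))))]
    ring
  rw [hsum, Polynomial.coeff_C_mul_X_pow]
  by_cases hjK : j = K
  · subst hjK
    rw [← h₂ x y z]
    by_cases he : α x + β y + γ z = j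
    · simp [he]
    · simp [he, Ne.symm he]
  · have hlt : j < K := lt_of_le_of_ne hj hjK
    simp only [hjK, if_false]
    by_cases he : j = α x + β y + γ z
    · rw [if_pos he]
      exact h₁ x y z (he ▸ hlt)
    · rw [if_neg he]

/-! ## The certificate: a size-20 diagonal of `Φ₃` and its weights -/

/-- Leg-`A` host coordinate (a `cw₂`-letter triple, i.e. an index `Fin 3 → Fin 3`) of each target coordinate. -/
def σA : Fin 20 → Fin 3 → Fin 3 :=
  ![![0, 0, 1], ![0, 0, 2], ![0, 1, 0], ![0, 1, 2], ![0, 2, 0], ![0, 2, 1], ![0, 2, 2], ![1, 0, 0],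
    ![1, 0, 1], ![1, 0, 2], ![1, 1, 2], ![1, 2, 0], ![1, 2, 1], ![1, 2, 2], ![2, 0, 2], ![2, 1, 0],
    ![2, 1, 1], ![2, 2, 0], ![2, 2, 1], ![2, 2, 2]]

/-- Leg-`A` weights (exponents of `ε`). -/
def wA : Fin 20 → ℕ :=
  ![38, 24, 26, 22, 41, 39, 40, 24, 27, 22, 22, 7, 18, 2, 24, 22, 34, 0, 10, 4]

/-- Leg-`B` host coordinate of each target coordinate. -/
def σB : Fin 20 → Fin 3 → Fin 3 :=
  ![![1, 2, 1], ![2, 1, 2], ![2, 0, 1], ![2, 0, 0], ![1, 0, 2], ![1, 0, 0], ![2, 0, 2], ![0, 1, 2],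
    ![1, 1, 0], ![1, 1, 2], ![0, 1, 0], ![1, 0, 1], ![0, 2, 0], ![0, 2, 2], ![2, 1, 0], ![2, 1, 1],
    ![0, 1, 1], ![0, 0, 2], ![2, 2, 1], ![2, 2, 0]]

/-- Leg-`B` weights. -/
def wB : Fin 20 → ℕ :=
  ![16, 13, 24, 14, 15, 17, 16, 14, 18, 14, 17, 16, 38, 33, 13, 0, 0, 53, 23, 30]

/-- Leg-`C` host coordinate of each target coordinate. -/
def σC : Fin 20 → Fin 3 → Fin 3 :=
  ![![1, 2, 0], ![2, 1, 0], ![2, 1, 1], ![2, 1, 2], ![1, 2, 2], ![1, 2, 1], ![2, 2, 0], ![1, 1, 2],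
    ![0, 1, 1], ![0, 1, 0], ![1, 0, 2], ![0, 2, 1], ![1, 0, 1], ![1, 0, 0], ![0, 1, 2], ![0, 0, 1],
    ![2, 0, 0], ![2, 2, 2], ![0, 0, 0], ![0, 0, 2]]

/-- Leg-`C` weights. -/
def wC : Fin 20 → ℕ :=
  ![2, 19, 6, 20, 0, 0, 0, 18, 11, 20, 17, 33, 0, 21, 19, 34, 22, 3, 23, 22]

/-- The host `cw₂^{⊠3}` over `ℤ` as an explicit triple product (for `decide`). -/
def hostZ (a b c : Fin 3 → Fin 3) : ℤ :=
  cwTensor ℤ 2 (a 0) (b 0) (c 0) * cwTensor ℤ 2 (a 1) (b 1) (c 1) * cwTensor ℤ 2 (a 2) (b 2) (c 2)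

/-- `hostZ` is the integer Kronecker cube of `T_{cw,2}`. [folklore] -/
theorem hostZ_eq (a b c : Fin 3 → Fin 3) : kroneckerPow (cwTensor ℤ 2) 3 a b c = hostZ a b c := by
  simp [kroneckerPow_apply, Fin.prod_univ_three, hostZ]

/-- Nothing below order `56`: every host entry met at weight `< 56` vanishes (by `decide`, row by row). -/
theorem cert₁ : ∀ x y z : Fin 20, wA x + wB y + wC z < 56 → hostZ (σA x) (σB y) (σC z) = 0 := by
  intro x
  fin_cases x <;> decide

/-- The order-`56` layer is `⟨20⟩` (by `decide`, row by row). -/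
theorem cert₂ : ∀ x y z : Fin 20,
    (if wA x + wB y + wC z = 56 then hostZ (σA x) (σB y) (σC z) else 0) = unitTensor ℤ 20 x y z := by
  intro x
  fin_cases x <;> decide

/-! ## `⟨20⟩ ⊴ cw₂^{⊠3}` -/

variable (R)

/-- The combinatorial degeneration of order `56`, as an approximate restriction with monomial matrices.
[cite: BurgisserClausenShokrollahi1997, (15.30)] -/
theorem isApproxRestriction :
    IsApproxRestriction 56 (kroneckerPow (cwTensor R 2) 3) (unitTensor R 20)
      (fun x a => if a = σA x then (X : R[X]) ^ (wA x) else 0)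
      (fun y b => if b = σB y then (X : R[X]) ^ (wB y) else 0)
      (fun z c => if c = σC z then (X : R[X]) ^ (wC z) else 0) := by
  refine isApproxRestriction_of_monomial 56 _ _ σA σB σC wA wB wC ?_ ?_
  · intro x y z h
    rw [← intCast_kroneckerPow_cwTensor R 2 3, hostZ_eq, cert₁ x y z h, Int.cast_zero]
  · intro x y z
    rw [← intCast_kroneckerPow_cwTensor R 2 3, hostZ_eq, ← intCast_unitTensor R 20 x y z, ← cert₂ x y z]
    split_ifs <;> simp

/-- **`⟨20⟩ ⊴ cw₂^{⊠3}`**: the unit tensor of size `20` is a degeneration (of order `56`) of the Kronecker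
cube of `T_{cw,2}`, over every commutative ring. [new] -/
theorem unitTensor_twenty_deg_cwTwoPow_three :
    AlgDegeneratesTo (kroneckerPow (cwTensor R 2) 3) (unitTensor R 20) :=
  ⟨56, _, _, _, isApproxRestriction R⟩

/-- Over `ℂ`: the border subrank of `cw₂^{⊠3}` is at least `20` (restriction: `14 ≤ Q ≤ 21`). [new] -/
theorem unitTensor_twenty_deg_cwTwoPow_three_complex :
    AlgDegeneratesTo (kroneckerPow (cwTensor ℂ 2) 3) (unitTensor ℂ 20) :=
  unitTensor_twenty_deg_cwTwoPow_three ℂ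

end Summit.MatrixMultiplication.MatrixMultiplication.Theorems.OutsiderSandwichBorderSubrankTwenty
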